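import Summits.CriticalPhenomena.PercolationContinuityZ3.Theorems.PercNearOneGluingNoHeavyLowerTailQ7PsiSetObserverGluedAllWeights
import Summits.CriticalPhenomena.PercolationContinuityZ3.Theorems.PercNearOneGluingNoHeavyLowerTailQ7PsiSetObserverQ9
import HarnessLib

/-!
# `NoHeavyLowerTail` (stmt-CriticalPhenomena-4575) — Kozma–Nitzan Question 9 at three relays in its GLUED form
# (pre-FKG (41) in `H/N` with designation in `H`), modulo the set-observer marker dominance lemma

Support file (`--supports stmt-CriticalPhenomena-4575`), coupling seat `prim-cplus-coupling` (gen 13).  No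
definitions, no named facts, no sorries.  Memo A5-COUPLING-gen13.md §1 (corrected), §5.

For an observer SET `N ∌ b` in a finite weighted graph `H`, the glued graph `H/N` (all of `N` identified to one vertex `[N]`) has
`[N] ↔ v ⟺ N ↔ v` and `c ↔ b ⟺ c ↔_H b ∨ (N ↔ c ∧ N ↔ b)`.  Kozma–Nitzan's Question 9 (arXiv:2401.12397 p. 36; designation in the
graph with the observer's edges removed) is, star by star at the observer, the inequality (41) in `H/N` with designation in `H`:
`(41)^glued_N:  μ_H(({z↔b} ∪ ({N↔z} ∩ {N↔b})) ∩ {N↔A}) ≤ μ_H({N↔b} ∩ {N↔A})`, `z = argmin_A μ_H(·↔b)` —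
prim-lf-3's "anchored q7_three" at `A = {x,y,z}`.  It is STRONGER than the set form of `…Q7PsiSetObserverQ9.lean` by
`μ_H(N↔b, N↔z, z↮b)`.
* `Q7Psi.glued_q7_of_psi` — reduction to the peeled form for an arbitrary left event;
* `Q7Psi.gluedPreFKG_three_of_gpsiGlued` — `(41)^glued_N` at `A = {x,y,z}` from the glued (restricted) form of (GΨ₃-set) on `H ∖ b`;
* `Q7Psi.gluedPreFKG_three_of_setMDL_allWeights` — the same, for every weight vector, from the set-observer marker dominance
  schema at non-degenerate weights (`Q7Psi.gpsi_three_glued_of_setMDL_allWeights`).  With the schema proved (prim-hp-7, in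
  progress) this is Kozma–Nitzan's Question 9 at `|A| = 3`.
[cite: KozmaNitzan2024, Question 9 (p. 36), Lemma 5 (p. 13), §5.1 (pp. 31–32)] [cite: Grimmett1999, §2.2 (product measure)]
-/

namespace Summit.CriticalPhenomena.PercolationContinuityZ3.Theorems

open MeasureTheory Set Literature.Probability.LatticeModels Literature.Probability.Percolation
open scoped Classical
open KNPreFKG

noncomputable section

namespace Q7Psi

universe u

variable {V : Type u} [Fintype V]

/-- **Reduction to the peeled form, arbitrary left event** (as `Q7Psi.set_q7_of_psi`): if `μ(X ∩ J) ≤ μ({N↔b} ∩ J)` for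
`J = ⋃_{a∈A} {N ↔ a in G∖b}`, then `μ(X ∩ {N↔A}) ≤ μ({N↔b} ∩ {N↔A})` — on `{N↔A} ∖ J` the observer set is joined to `b`.
[cite: KozmaNitzan2024, Question 9 (p. 36)] -/
theorem glued_q7_of_psi (w : Sym2 V → unitInterval) (N : Set V) (b : V) (X : Set (BondConfig V)) (A : Finset V)
    (hΨ : (prodBernoulli w).real (X ∩ ⋃ a ∈ A, {ω : BondConfig V | ∃ n ∈ N, ω ∈ openConnIn ({b}ᶜ : Set V) n a}) ≤
      (prodBernoulli w).real ({ω : BondConfig V | ∃ n ∈ N, (openGraph ω).Reachable n b} ∩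
        ⋃ a ∈ A, {ω : BondConfig V | ∃ n ∈ N, ω ∈ openConnIn ({b}ᶜ : Set V) n a})) :
    (prodBernoulli w).real (X ∩ ⋃ a ∈ A, {ω : BondConfig V | ∃ n ∈ N, (openGraph ω).Reachable n a}) ≤
      (prodBernoulli w).real ({ω : BondConfig V | ∃ n ∈ N, (openGraph ω).Reachable n b} ∩
        ⋃ a ∈ A, {ω : BondConfig V | ∃ n ∈ N, (openGraph ω).Reachable n a}) := by
  set μ := prodBernoulli w with hμ
  set J : Set (BondConfig V) := ⋃ a ∈ A, {ω : BondConfig V | ∃ n ∈ N, ω ∈ openConnIn ({b}ᶜ : Set V) n a} with hJ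
  set U : Set (BondConfig V) := ⋃ a ∈ A, {ω : BondConfig V | ∃ n ∈ N, (openGraph ω).Reachable n a} with hU
  set Ob : Set (BondConfig V) := {ω : BondConfig V | ∃ n ∈ N, (openGraph ω).Reachable n b} with hOb
  have hJU : J ⊆ U := by
    intro ω hω
    simp only [hJ, hU, mem_iUnion, mem_setOf_eq] at hω ⊢
    obtain ⟨a, ha, n, hn, h⟩ := hω
    exact ⟨a, ha, n, hn, KNPreFKG.reachable_of_openConnIn h⟩
  have hUJ : U \ J ⊆ Ob := by
    rintro ω ⟨hωU, hωJ⟩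
    simp only [hJ, hU, mem_iUnion, mem_setOf_eq] at hωU hωJ
    obtain ⟨a, ha, n, hn, h⟩ := hωU
    have hn' : ω ∉ openConnIn ({b}ᶜ : Set V) n a := fun h' => hωJ ⟨a, ha, n, hn, h'⟩
    exact ⟨n, hn, reachable_of_not_openConnIn_compl h hn'⟩
  have msplit : ∀ Y : Set (BondConfig V), μ.real (Y ∩ U) = μ.real (Y ∩ J) + μ.real (Y ∩ (U \ J)) := by
    intro Y
    have hdj : Disjoint (Y ∩ J) (Y ∩ (U \ J)) := by
      rw [Set.disjoint_left]
      rintro ω ⟨-, hωJ⟩ ⟨-, -, hωJ'⟩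
      exact hωJ' hωJ
    rw [← measureReal_union hdj MeasurableSet.of_discrete]
    congr 1
    ext ω
    simp only [mem_inter_iff, mem_union, mem_sdiff]
    constructor
    · rintro ⟨hY, hωU⟩
      by_cases hωJ : ω ∈ J
      · exact Or.inl ⟨hY, hωJ⟩
      · exact Or.inr ⟨hY, hωU, hωJ⟩
    · rintro (⟨hY, hωJ⟩ | ⟨hY, hωU, -⟩)
      · exact ⟨hY, hJU hωJ⟩
      · exact ⟨hY, hωU⟩
  have h1 : μ.real (X ∩ (U \ J)) ≤ μ.real (U \ J) := measureReal_mono inter_subset_right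
  have h2 : μ.real (Ob ∩ (U \ J)) = μ.real (U \ J) := by
    congr 1
    exact inter_eq_right.2 hUJ
  rw [msplit X, msplit Ob, h2]
  linarith


/-- **`(41)^glued_N` at three relays from the glued form of (GΨ₃-set) on `G ∖ b`.**  `N ∌ b` an observer set, `x, y, z ≠ b`
distinct relays with `μ(z↔b) ≤ μ(x↔b), μ(y↔b)` in `G`.  IF on `G ∖ b` (vertex type `↥{b}ᶜ`, induced weights), for every monotone `F`
with `E F(C_z) ≤ E F(C_x), E F(C_y)`, `∫_{J' ∩ {z↮N}} F(C_z) ≤ ∫_{J' ∩ {z↮N}} F(C_N)` (`J' = {x↔N} ∪ {y↔N}`), THEN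
`μ(({z↔b} ∪ ({N↔z} ∩ {N↔b})) ∩ {N↔A}) ≤ μ({N↔b} ∩ {N↔A})`, `A = {x,y,z}`.
Proof: `glued_q7_of_psi`; with `J_v = {N ↔ v in G∖b}`: on `J_z` the left event IS `{N↔b}` (a path `N–z` off `b` and `z↔b` give
`N↔b`; conversely `N↔b` and `N↔z` is the second member); off `J_z`, `N↔z` forces the path through `b`, so the left event is
`{z↔b}`; hence everything reduces to `μ({z↔b} ∩ (J_x∪J_y) ∩ J_zᶜ) ≤ μ({N↔b} ∩ (J_x∪J_y) ∩ J_zᶜ)`, which the two green bridges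
turn into the restricted (GΨ₃-set) on `G ∖ b` for the green function.
[cite: KozmaNitzan2024, Question 9 (p. 36), Lemma 5 (p. 13), §5.1 (pp. 31–32)] -/
theorem gluedPreFKG_three_of_gpsiGlued (w : Sym2 V → unitInterval) (N : Set V) (b x y z : V) (hbN : b ∉ N)
    (hxb : x ≠ b) (hyb : y ≠ b) (hzb : z ≠ b)
    (hG : ∀ F : Set ({b}ᶜ : Set V) → ℝ, (∀ T T' : Set ({b}ᶜ : Set V), T ⊆ T' → F T ≤ F T') →
      (∫ ω', F (openCluster ω' ⟨z, mem_compl_singleton_iff.2 hzb⟩) ∂(prodBernoulli (w ∘ Sym2.map (Subtype.val : ({b}ᶜ : Set V) → V))) ≤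
        ∫ ω', F (openCluster ω' ⟨x, mem_compl_singleton_iff.2 hxb⟩) ∂(prodBernoulli (w ∘ Sym2.map (Subtype.val : ({b}ᶜ : Set V) → V)))) →
      (∫ ω', F (openCluster ω' ⟨z, mem_compl_singleton_iff.2 hzb⟩) ∂(prodBernoulli (w ∘ Sym2.map (Subtype.val : ({b}ᶜ : Set V) → V))) ≤
        ∫ ω', F (openCluster ω' ⟨y, mem_compl_singleton_iff.2 hyb⟩) ∂(prodBernoulli (w ∘ Sym2.map (Subtype.val : ({b}ᶜ : Set V) → V)))) →
      ∫ ω' in ({ω' : BondConfig ({b}ᶜ : Set V) | ∃ n ∈ (Subtype.val : ({b}ᶜ : Set V) → V) ⁻¹' N,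
            (openGraph ω').Reachable ⟨x, mem_compl_singleton_iff.2 hxb⟩ n} ∪
          {ω' | ∃ n ∈ (Subtype.val : ({b}ᶜ : Set V) → V) ⁻¹' N, (openGraph ω').Reachable ⟨y, mem_compl_singleton_iff.2 hyb⟩ n}) ∩
          {ω' | ∀ n ∈ (Subtype.val : ({b}ᶜ : Set V) → V) ⁻¹' N, ¬ (openGraph ω').Reachable ⟨z, mem_compl_singleton_iff.2 hzb⟩ n},
          F (openCluster ω' ⟨z, mem_compl_singleton_iff.2 hzb⟩) ∂(prodBernoulli (w ∘ Sym2.map (Subtype.val : ({b}ᶜ : Set V) → V))) ≤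
        ∫ ω' in ({ω' : BondConfig ({b}ᶜ : Set V) | ∃ n ∈ (Subtype.val : ({b}ᶜ : Set V) → V) ⁻¹' N,
            (openGraph ω').Reachable ⟨x, mem_compl_singleton_iff.2 hxb⟩ n} ∪
          {ω' | ∃ n ∈ (Subtype.val : ({b}ᶜ : Set V) → V) ⁻¹' N, (openGraph ω').Reachable ⟨y, mem_compl_singleton_iff.2 hyb⟩ n}) ∩
          {ω' | ∀ n ∈ (Subtype.val : ({b}ᶜ : Set V) → V) ⁻¹' N, ¬ (openGraph ω').Reachable ⟨z, mem_compl_singleton_iff.2 hzb⟩ n},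
          F (⋃ n ∈ (Subtype.val : ({b}ᶜ : Set V) → V) ⁻¹' N, openCluster ω' n)
            ∂(prodBernoulli (w ∘ Sym2.map (Subtype.val : ({b}ᶜ : Set V) → V))))
    (hzx : (prodBernoulli w).real (openConn z b) ≤ (prodBernoulli w).real (openConn x b))
    (hzy : (prodBernoulli w).real (openConn z b) ≤ (prodBernoulli w).real (openConn y b)) :
    (prodBernoulli w).real ((openConn z b ∪ ({ω : BondConfig V | ∃ n ∈ N, (openGraph ω).Reachable n z} ∩
        {ω : BondConfig V | ∃ n ∈ N, (openGraph ω).Reachable n b})) ∩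
        ⋃ a ∈ ({x, y, z} : Finset V), {ω : BondConfig V | ∃ n ∈ N, (openGraph ω).Reachable n a}) ≤
      (prodBernoulli w).real ({ω : BondConfig V | ∃ n ∈ N, (openGraph ω).Reachable n b} ∩
        ⋃ a ∈ ({x, y, z} : Finset V), {ω : BondConfig V | ∃ n ∈ N, (openGraph ω).Reachable n a}) := by
  classical
  set μ := prodBernoulli w with hμ
  have hmeas : ∀ T : Set (BondConfig V), MeasurableSet T := fun _ => MeasurableSet.of_discrete
  set Ob : Set (BondConfig V) := {ω : BondConfig V | ∃ n ∈ N, (openGraph ω).Reachable n b} with hOb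
  set Oz : Set (BondConfig V) := {ω : BondConfig V | ∃ n ∈ N, (openGraph ω).Reachable n z} with hOz
  set L : Set (BondConfig V) := openConn z b ∪ (Oz ∩ Ob) with hL
  -- (1) reduction to the peeled form
  refine glued_q7_of_psi w N b L ({x, y, z} : Finset V) ?_
  set Jx : Set (BondConfig V) := {ω : BondConfig V | ∃ n ∈ N, ω ∈ openConnIn ({b}ᶜ : Set V) n x} with hJx
  set Jy : Set (BondConfig V) := {ω : BondConfig V | ∃ n ∈ N, ω ∈ openConnIn ({b}ᶜ : Set V) n y} with hJy
  set Jz : Set (BondConfig V) := {ω : BondConfig V | ∃ n ∈ N, ω ∈ openConnIn ({b}ᶜ : Set V) n z} with hJz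
  have hJ : ∀ X : Set (BondConfig V),
      X ∩ (⋃ a ∈ ({x, y, z} : Finset V), {ω : BondConfig V | ∃ n ∈ N, ω ∈ openConnIn ({b}ᶜ : Set V) n a}) =
      X ∩ ((Jx ∪ Jy) ∪ Jz) := by
    intro X; congr 1; ext ω
    simp only [hJx, hJy, hJz, Finset.mem_insert, Finset.mem_singleton, mem_iUnion, mem_union, mem_setOf_eq,
      exists_prop]
    constructor
    · rintro ⟨a, ha, n, hn, h⟩
      rcases ha with rfl | rfl | rfl
      · exact Or.inl (Or.inl ⟨n, hn, h⟩)
      · exact Or.inl (Or.inr ⟨n, hn, h⟩)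
      · exact Or.inr ⟨n, hn, h⟩
    · rintro ((⟨n, hn, h⟩ | ⟨n, hn, h⟩) | ⟨n, hn, h⟩)
      · exact ⟨x, Or.inl rfl, n, hn, h⟩
      · exact ⟨y, Or.inr (Or.inl rfl), n, hn, h⟩
      · exact ⟨z, Or.inr (Or.inr rfl), n, hn, h⟩
  rw [hJ, hJ]
  -- (2) split along `J_z`: there the left event is `{N↔b}`; off `J_z` it is `{z↔b}`
  have hLJz : L ∩ Jz = Ob ∩ Jz := by
    ext ω
    simp only [hL, hOb, hOz, hJz, mem_inter_iff, mem_union, mem_setOf_eq]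
    constructor
    · rintro ⟨hLω, n, hn, hnz⟩
      refine ⟨?_, n, hn, hnz⟩
      rcases hLω with hzb' | ⟨_, hb'⟩
      · exact ⟨n, hn, (reachable_of_openConnIn hnz).trans hzb'⟩
      · exact hb'
    · rintro ⟨hb', n, hn, hnz⟩
      exact ⟨Or.inr ⟨⟨n, hn, reachable_of_openConnIn hnz⟩, hb'⟩, n, hn, hnz⟩
  have hLJzc : L ∩ Jzᶜ = openConn z b ∩ Jzᶜ := by
    ext ω
    simp only [hL, hOb, hOz, hJz, mem_inter_iff, mem_union, mem_compl_iff, mem_setOf_eq, not_exists, not_and]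
    constructor
    · rintro ⟨hLω, hnJ⟩
      refine ⟨?_, hnJ⟩
      rcases hLω with hzb' | ⟨⟨n, hn, hnz⟩, _⟩
      · exact hzb'
      · -- `n ↔ z` but not off `b`: the path passes through `b`, so `z ↔ b`
        exact hnz.symm.trans (reachable_of_not_openConnIn_compl hnz (hnJ n hn))
    · rintro ⟨hzb', hnJ⟩
      exact ⟨Or.inl hzb', hnJ⟩
  have msplit : ∀ X : Set (BondConfig V), μ.real (X ∩ ((Jx ∪ Jy) ∪ Jz)) =
      μ.real ((X ∩ Jz) ∩ ((Jx ∪ Jy) ∪ Jz)) + μ.real ((X ∩ Jzᶜ) ∩ (Jx ∪ Jy)) := by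
    intro X
    have hdj : Disjoint ((X ∩ Jz) ∩ ((Jx ∪ Jy) ∪ Jz)) ((X ∩ Jzᶜ) ∩ (Jx ∪ Jy)) := by
      rw [Set.disjoint_left]
      rintro ω ⟨⟨-, h⟩, -⟩ ⟨⟨-, hn⟩, -⟩
      exact hn h
    rw [← measureReal_union hdj (hmeas _)]
    congr 1
    ext ω
    simp only [mem_inter_iff, mem_union, mem_compl_iff]
    tauto
  rw [msplit L, msplit Ob, hLJz, hLJzc]
  suffices key : μ.real ((openConn z b ∩ Jzᶜ) ∩ (Jx ∪ Jy)) ≤ μ.real ((Ob ∩ Jzᶜ) ∩ (Jx ∪ Jy)) by linarith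
  -- (3) pass to `G ∖ b`
  set S : Set V := {b}ᶜ with hS
  set r := restrictConfig (Subtype.val : S → V) with hr
  set w' : Sym2 S → unitInterval := w ∘ Sym2.map (Subtype.val : S → V) with hw'
  set μ' := prodBernoulli w' with hμ'
  set x' : S := ⟨x, mem_compl_singleton_iff.2 hxb⟩ with hx'
  set y' : S := ⟨y, mem_compl_singleton_iff.2 hyb⟩ with hy'
  set z' : S := ⟨z, mem_compl_singleton_iff.2 hzb⟩ with hz'
  set N' : Set S := (Subtype.val : S → V) ⁻¹' N with hN'
  set E₀ : Set (BondConfig S) := ({ω' : BondConfig S | ∃ n ∈ N', (openGraph ω').Reachable x' n} ∪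
      {ω' | ∃ n ∈ N', (openGraph ω').Reachable y' n}) ∩ {ω' | ∀ n ∈ N', ¬ (openGraph ω').Reachable z' n} with hE₀
  have hnb : ∀ n ∈ N, n ≠ b := fun n hn h => hbN (h ▸ hn)
  have hJpre : ∀ (v : V) (hvb : v ≠ b),
      {ω : BondConfig V | ∃ n ∈ N, ω ∈ openConnIn ({b}ᶜ : Set V) n v} =
        r ⁻¹' {ω' : BondConfig S | ∃ n ∈ N', (openGraph ω').Reachable ⟨v, mem_compl_singleton_iff.2 hvb⟩ n} := by
    intro v hvb; ext ω
    simp only [mem_setOf_eq, mem_preimage, hN']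
    constructor
    · rintro ⟨n, hn, h⟩
      refine ⟨⟨n, mem_compl_singleton_iff.2 (hnb n hn)⟩, hn, ?_⟩
      rw [reachable_restrictConfig_val_iff]
      rw [openConnIn_comm]; exact h
    · rintro ⟨n', hn', h⟩
      refine ⟨n', hn', ?_⟩
      rw [reachable_restrictConfig_val_iff] at h
      rw [openConnIn_comm]; exact h
  have hJE : Jzᶜ ∩ (Jx ∪ Jy) = r ⁻¹' E₀ := by
    rw [hE₀, preimage_inter, preimage_union, hJx, hJy, hJz, hJpre x hxb, hJpre y hyb, hJpre z hzb, inter_comm,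
      ← preimage_compl]
    congr 2
    ext ω'
    simp only [mem_compl_iff, mem_setOf_eq, not_exists, not_and]
    exact Iff.rfl
  have hJE' : ∀ X : Set (BondConfig V), (X ∩ Jzᶜ) ∩ (Jx ∪ Jy) = X ∩ r ⁻¹' E₀ := by
    intro X; rw [inter_assoc, hJE]
  rw [hJE', hJE']
  -- the green function and the two bridges
  set F : Set S → ℝ := fun T => μ.real {ω₁ : BondConfig V | ∃ s ∈ Subtype.val '' T, s ≠ b ∧ s(b, s) ∈ ω₁} with hF
  have hFmono : ∀ T T' : Set S, T ⊆ T' → F T ≤ F T' := by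
    intro T T' hTT'
    refine measureReal_mono fun ω₁ hω₁ => ?_
    obtain ⟨s, hs, hsb, hso⟩ := hω₁
    exact ⟨s, image_mono hTT' hs, hsb, hso⟩
  have hbridge : ∀ (v : V) (hvb : v ≠ b) (E₁ : Set (BondConfig S)),
      μ.real (openConn v b ∩ r ⁻¹' E₁) = ∫ ω' in E₁, F (openCluster ω' ⟨v, mem_compl_singleton_iff.2 hvb⟩) ∂μ' := by
    intro v hvb E₁
    rw [inter_comm, hr, real_inter_openConn_eq_integral_green w b v hvb E₁, ← integral_indicator (hmeas _),
      hμ', hw', ← integral_indicator (MeasurableSet.of_discrete), ← integral_comp_restrictConfig_val]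
    refine integral_congr_ae (Filter.Eventually.of_forall fun ω => ?_)
    change (restrictConfig Subtype.val ⁻¹' E₁).indicator _ ω = E₁.indicator _ (restrictConfig Subtype.val ω)
    have hfun : (fun ω : BondConfig V => μ.real {ω₁ : BondConfig V | ∃ s ∈ {y | ω ∈ openConnIn ({b}ᶜ : Set V) v y},
        s ≠ b ∧ s(b, s) ∈ ω₁}) =
        (fun ω' => F (openCluster ω' ⟨v, mem_compl_singleton_iff.2 hvb⟩)) ∘ restrictConfig (Subtype.val : S → V) := by
      funext ω
      simp only [Function.comp_apply, hF]
      rw [setOf_openConnIn_eq_image b ω ⟨v, mem_compl_singleton_iff.2 hvb⟩]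
    rw [hfun]
    exact indicator_comp_right _
  have hsetcl : ∀ ω : BondConfig V, {y | ∃ n ∈ N, ω ∈ openConnIn ({b}ᶜ : Set V) n y} =
      Subtype.val '' ⋃ n ∈ N', openCluster (restrictConfig (Subtype.val : S → V) ω) n := by
    intro ω
    rw [image_iUnion₂]
    ext v
    simp only [mem_setOf_eq, mem_iUnion, hN', mem_preimage, exists_prop]
    constructor
    · rintro ⟨n, hn, h⟩
      refine ⟨⟨n, mem_compl_singleton_iff.2 (hnb n hn)⟩, hn, ?_⟩
      rw [← setOf_openConnIn_eq_image b ω ⟨n, _⟩]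
      exact h
    · rintro ⟨n', hn', h⟩
      refine ⟨n', hn', ?_⟩
      rw [← setOf_openConnIn_eq_image b ω n'] at h
      exact h
  have hbridgeN : ∀ (E₁ : Set (BondConfig S)),
      μ.real (Ob ∩ r ⁻¹' E₁) = ∫ ω' in E₁, F (⋃ n ∈ N', openCluster ω' n) ∂μ' := by
    intro E₁
    rw [inter_comm, hr, hOb, real_inter_setReach_eq_integral_green w b N hbN E₁, ← integral_indicator (hmeas _),
      hμ', hw', ← integral_indicator (MeasurableSet.of_discrete), ← integral_comp_restrictConfig_val]
    refine integral_congr_ae (Filter.Eventually.of_forall fun ω => ?_)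
    change (restrictConfig Subtype.val ⁻¹' E₁).indicator _ ω = E₁.indicator _ (restrictConfig Subtype.val ω)
    have hfun : (fun ω : BondConfig V => μ.real {ω₁ : BondConfig V | ∃ s ∈ {y | ∃ n ∈ N, ω ∈ openConnIn ({b}ᶜ : Set V) n y},
        s ≠ b ∧ s(b, s) ∈ ω₁}) =
        (fun ω' => F (⋃ n ∈ N', openCluster ω' n)) ∘ restrictConfig (Subtype.val : S → V) := by
      funext ω
      simp only [Function.comp_apply, hF]
      rw [hsetcl ω]
    rw [hfun]
    exact indicator_comp_right _
  have htau : ∀ (v : V) (hvb : v ≠ b), μ.real (openConn v b) =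
      ∫ ω', F (openCluster ω' ⟨v, mem_compl_singleton_iff.2 hvb⟩) ∂μ' := by
    intro v hvb
    rw [← setIntegral_univ, ← hbridge v hvb univ, preimage_univ, inter_univ]
  have hx'' : ∫ ω', F (openCluster ω' z') ∂μ' ≤ ∫ ω', F (openCluster ω' x') ∂μ' := by
    rw [← htau z hzb, ← htau x hxb]; exact hzx
  have hy'' : ∫ ω', F (openCluster ω' z') ∂μ' ≤ ∫ ω', F (openCluster ω' y') ∂μ' := by
    rw [← htau z hzb, ← htau y hyb]; exact hzy
  rw [hbridge z hzb E₀, hbridgeN E₀]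
  exact hG F hFmono hx'' hy''

/-- **Kozma–Nitzan Question 9 at three relays, glued form, every weight vector — modulo the set-observer marker dominance schema.**
If the schema `hMDL` (the `x`-side marker dominance lemma at all non-degenerate weights, all distinct `x, y, z`, all observer sets,
all monotone `G`) holds on every finite vertex type of the universe, then on every finite weighted graph, for every observer set
`N ∌ b` and relays `x, y, z ≠ b` (distinct) with `μ(z↔b) ≤ μ(x↔b), μ(y↔b)`:
`μ(({z↔b} ∪ ({N↔z} ∩ {N↔b})) ∩ {N↔A}) ≤ μ({N↔b} ∩ {N↔A})`, `A = {x,y,z}` — (41) in `G/N` with designation in `G`.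
[cite: KozmaNitzan2024, Question 9 (p. 36), §5.1 (pp. 31–32)] -/
theorem gluedPreFKG_three_of_setMDL_allWeights
    (hMDL : ∀ (W : Type u) [Fintype W] (p : Sym2 W → unitInterval), (∀ e, 0 < p e ∧ p e < 1) →
      ∀ (x y z : W) (N : Set W), x ≠ y → x ≠ z → y ≠ z → ∀ G : Set W → ℝ, (∀ S T : Set W, S ⊆ T → G S ≤ G T) →
      (prodBernoulli p).real ({ω : BondConfig W | ∃ n ∈ N, (openGraph ω).Reachable y n} ∩
            ({ω | ∀ n ∈ N, ¬ (openGraph ω).Reachable x n} ∩ {ω | ∀ n ∈ N, ¬ (openGraph ω).Reachable z n})) *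
        ((prodBernoulli p).real {ω : BondConfig W | ¬ (openGraph ω).Reachable x z} *
            (∫ ω in openConn x y ∩ {ω | ¬ (openGraph ω).Reachable x z}, G (openCluster ω x) ∂(prodBernoulli p)) -
          (prodBernoulli p).real (openConn x y ∩ {ω | ¬ (openGraph ω).Reachable x z}) *
            ∫ ω in {ω : BondConfig W | ¬ (openGraph ω).Reachable x z}, G (openCluster ω x) ∂(prodBernoulli p)) ≤
      (prodBernoulli p).real ({ω : BondConfig W | ¬ (openGraph ω).Reachable y x} ∩
          {ω | ¬ (openGraph ω).Reachable y z}) *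
        ((prodBernoulli p).real {ω : BondConfig W | ¬ (openGraph ω).Reachable x z} *
            (∫ ω in {ω : BondConfig W | ∃ n ∈ N, (openGraph ω).Reachable x n} ∩
              {ω | ∀ n ∈ N, ¬ (openGraph ω).Reachable z n}, G (openCluster ω x) ∂(prodBernoulli p)) -
          (prodBernoulli p).real ({ω : BondConfig W | ∃ n ∈ N, (openGraph ω).Reachable x n} ∩
              {ω | ∀ n ∈ N, ¬ (openGraph ω).Reachable z n}) *
            ∫ ω in {ω : BondConfig W | ¬ (openGraph ω).Reachable x z}, G (openCluster ω x) ∂(prodBernoulli p)))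
    (w : Sym2 V → unitInterval) (N : Set V) (b x y z : V) (hbN : b ∉ N)
    (hxb : x ≠ b) (hyb : y ≠ b) (hzb : z ≠ b) (hxy : x ≠ y) (hxz : x ≠ z) (hyz : y ≠ z)
    (hzx : (prodBernoulli w).real (openConn z b) ≤ (prodBernoulli w).real (openConn x b))
    (hzy : (prodBernoulli w).real (openConn z b) ≤ (prodBernoulli w).real (openConn y b)) :
    (prodBernoulli w).real ((openConn z b ∪ ({ω : BondConfig V | ∃ n ∈ N, (openGraph ω).Reachable n z} ∩
        {ω : BondConfig V | ∃ n ∈ N, (openGraph ω).Reachable n b})) ∩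
        ⋃ a ∈ ({x, y, z} : Finset V), {ω : BondConfig V | ∃ n ∈ N, (openGraph ω).Reachable n a}) ≤
      (prodBernoulli w).real ({ω : BondConfig V | ∃ n ∈ N, (openGraph ω).Reachable n b} ∩
        ⋃ a ∈ ({x, y, z} : Finset V), {ω : BondConfig V | ∃ n ∈ N, (openGraph ω).Reachable n a}) := by
  haveI : Fintype ({b}ᶜ : Set V) := Fintype.ofFinite _
  have hxy' : (⟨x, mem_compl_singleton_iff.2 hxb⟩ : ({b}ᶜ : Set V)) ≠ ⟨y, mem_compl_singleton_iff.2 hyb⟩ :=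
    fun h => hxy (congrArg Subtype.val h)
  have hxz' : (⟨x, mem_compl_singleton_iff.2 hxb⟩ : ({b}ᶜ : Set V)) ≠ ⟨z, mem_compl_singleton_iff.2 hzb⟩ :=
    fun h => hxz (congrArg Subtype.val h)
  have hyz' : (⟨y, mem_compl_singleton_iff.2 hyb⟩ : ({b}ᶜ : Set V)) ≠ ⟨z, mem_compl_singleton_iff.2 hzb⟩ :=
    fun h => hyz (congrArg Subtype.val h)
  refine gluedPreFKG_three_of_gpsiGlued w N b x y z hbN hxb hyb hzb (fun F hF hx hy => ?_) hzx hzy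
  exact gpsi_three_glued_of_setMDL_allWeights (hMDL ({b}ᶜ : Set V)) (w ∘ Sym2.map (Subtype.val : ({b}ᶜ : Set V) → V))
    _ _ _ _ hxy' hxz' hyz' F hF hx hy


end Q7Psi

end

end Summit.CriticalPhenomena.PercolationContinuityZ3.Theorems
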